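import Mathlib
import Summits.Ventures.PercRepro.TriangleCapBandNoGap

/-!
# PercRepro — THE BAND ON `n` VERTICES, EVERY `ℓ`, IN ONE STATEMENT; THE PAIR-COUNT SPECTRUM OF A LAYER ON EXACTLY
`n` VERTICES (p3, gen 53; part 276)

**`band_iff_all`** (`2 ≤ ℓ`, `1 ≤ t`, `2 t ≤ s`): the band value `2 j` is attained on `ℓ + 1 + (s − t)` vertices IFF
`j` satisfies the three extremal bounds of part 247 (`2 j ≤ t (t + 1)`; `2 j + 2 t ≤ t (t − 1) + 2 ℓ` when `t ≤ ℓ`;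
`2 j + 2 q t ≤ t (t − 1) + ℓ q (q + 1)`, `q = ⌊t/ℓ⌋`, when `ℓ ≤ t`) AND `j` is never strictly between the top
`B(u) + W(u, ℓ)` of a sub-band and the bottom `B(u + 1)` of the next — for `ℓ ≥ t − 2` the sub-bands overlap from the
star on (part 273: the band is the full interval), for `ℓ ≤ t − 3` this is part 275.

**`pair_count_vertices_iff`**: on exactly `n` vertices with `s` edges (`1 ≤ t`, `2 t ≤ s`, `s − t + 3 ≤ n`) a
triangle-free graph with a vertex of degree `s − t` and `Σ d² + 2 t (s − t − 1) + 2 j = s (s + 1)` exists IFF the same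
conditions hold with `ℓ = n − 1 − (s − t)` non-neighbours — THE PAIR-COUNT SPECTRUM OF THE LAYER `t` ON `n` VERTICES,
with no parameter left.  Axioms: standard.
-/

namespace PercRepro

namespace TriangleCap

namespace C047

open Finset

/-- No gap above an overlapping sub-band: if `2 B(u + 1) ≤ 2 B(u) + twoW ℓ u + 2` then `2 j` is not strictly between
`2 B(u) + twoW ℓ u` and `2 B(u + 1)` (parity). -/
theorem no_gap_of_overlap (ℓ t u j : ℕ)
    (hov : 2 * ((u + 1) * (t - u - 2)) ≤ 2 * (u * (t - u - 1)) + twoW ℓ u + 2) :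
    ¬ (2 * (u * (t - u - 1)) + twoW ℓ u < 2 * j ∧ j < (u + 1) * (t - u - 2)) := by
  rintro ⟨h1, h2⟩
  obtain ⟨x, hx⟩ := twoW_even ℓ u
  omega

/-- **THE BAND ON `n` VERTICES, EVERY `ℓ`, IN ONE STATEMENT:** for `2 ≤ ℓ`, `1 ≤ t`, `2 t ≤ s`, the band value `2 j` is
attained on `ℓ + 1 + (s − t)` vertices IFF `j` satisfies the three extremal bounds of part 247 and, for no `u`,
`2 u (t − u − 1) + twoW ℓ u < 2 j` and `j < (u + 1)(t − u − 2)`. -/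
theorem band_iff_all (ℓ s t j : ℕ) (hℓ : 2 ≤ ℓ) (ht : 1 ≤ t) (hs : 2 * t ≤ s) :
    (∃ (H : SimpleGraph (Fin (ℓ + 1 + (s - t)))) (_ : DecidableRel H.Adj), H.CliqueFree 3 ∧
      H.edgeFinset.card = s ∧ (∃ w, deg H w + t = s) ∧
      ∑ v, deg H v * deg H v + 2 * (t * (s - t - 1)) + 2 * j = s * (s + 1)) ↔
    ((2 * j ≤ t * (t + 1) ∧ (t ≤ ℓ → 2 * j + 2 * t ≤ t * (t - 1) + 2 * ℓ) ∧
        (ℓ ≤ t → 2 * j + 2 * (t / ℓ) * t ≤ t * (t - 1) + ℓ * ((t / ℓ) * (t / ℓ + 1)))) ∧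
      ∀ u, ¬ (2 * (u * (t - u - 1)) + twoW ℓ u < 2 * j ∧ j < (u + 1) * (t - u - 2))) := by
  rcases Nat.lt_or_ge (ℓ + 2) t with h3 | h2
  · -- `ℓ + 3 ≤ t`: part 275; the two other bounds follow from the small-regime bound
    rw [band_iff_no_gap ℓ s t j hℓ (by omega) hs]
    have hq1 : 1 ≤ t / ℓ := Nat.div_pos (by omega) (by omega)
    have hqt : ℓ * (t / ℓ) ≤ t := Nat.mul_div_le t ℓ
    constructor
    · rintro ⟨hb, hng⟩
      refine ⟨⟨?_, fun h => by omega, fun _ => hb⟩, hng⟩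
      -- `2 j ≤ t (t − 1) + ℓ q (q + 1) − 2 q t ≤ t (t + 1)`
      have h1 : ℓ * ((t / ℓ) * (t / ℓ + 1)) ≤ 2 * (t / ℓ) * t := by
        have : ℓ * ((t / ℓ) * (t / ℓ + 1)) = (t / ℓ) * (ℓ * (t / ℓ)) + ℓ * (t / ℓ) := by ring
        rw [this]
        have h2 : (t / ℓ) * (ℓ * (t / ℓ)) ≤ (t / ℓ) * t := Nat.mul_le_mul_left _ hqt
        nlinarith
      have h3 : t * (t - 1) ≤ t * (t + 1) := Nat.mul_le_mul_left _ (by omega)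
      omega
    · rintro ⟨⟨-, -, hb⟩, hng⟩
      exact ⟨hb (by omega), hng⟩
  · -- `t ≤ ℓ + 2`: the full interval (part 273); no gap from the star on
    constructor
    · rintro ⟨H, _, hfree, hs', ⟨w, hw⟩, hj'⟩
      refine ⟨(vertex_band_extremal ℓ s t (by omega) ht hs).1 H hfree hs' w hw j hj', fun u => ?_⟩
      have hov0 : 2 * ((0 + 1) * (t - 0 - 2)) ≤ 2 * (0 * (t - 0 - 1)) + twoW ℓ 0 + 2 := by
        rw [twoW_zero]
        omega
      exact no_gap_of_overlap ℓ t u j (overlap_of_le ℓ t 0 hov0 u (Nat.zero_le u))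
    · rintro ⟨⟨hb1, hb2, hb3⟩, -⟩
      exact (band_interval_iff_all ℓ s t hℓ ht hs).mpr h2 j hb1 hb2 hb3

/-- **THE PAIR-COUNT SPECTRUM OF THE LAYER `t` ON EXACTLY `n` VERTICES:** for `1 ≤ t`, `2 t ≤ s`, `s − t + 3 ≤ n` and
`ℓ = n − 1 − (s − t)`, a triangle-free graph on `n` vertices with `s` edges, a vertex of degree `s − t` and
`Σ d² + 2 t (s − t − 1) + 2 j = s (s + 1)` exists IFF `j` satisfies the three extremal bounds with `ℓ` non-neighbours and
is never strictly between the top of a sub-band and the bottom of the next. -/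
theorem pair_count_vertices_iff (n s t j : ℕ) (ht : 1 ≤ t) (hs : 2 * t ≤ s) (hn : s - t + 3 ≤ n) :
    (∃ (H : SimpleGraph (Fin n)) (_ : DecidableRel H.Adj), H.CliqueFree 3 ∧
      H.edgeFinset.card = s ∧ (∃ w, deg H w + t = s) ∧
      ∑ v, deg H v * deg H v + 2 * (t * (s - t - 1)) + 2 * j = s * (s + 1)) ↔
    ((2 * j ≤ t * (t + 1) ∧ (t ≤ n - 1 - (s - t) → 2 * j + 2 * t ≤ t * (t - 1) + 2 * (n - 1 - (s - t))) ∧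
        (n - 1 - (s - t) ≤ t → 2 * j + 2 * (t / (n - 1 - (s - t))) * t ≤
          t * (t - 1) + (n - 1 - (s - t)) * ((t / (n - 1 - (s - t))) * (t / (n - 1 - (s - t)) + 1)))) ∧
      ∀ u, ¬ (2 * (u * (t - u - 1)) + twoW (n - 1 - (s - t)) u < 2 * j ∧ j < (u + 1) * (t - u - 2))) := by
  obtain ⟨ℓ, hℓ⟩ : ∃ ℓ, n - 1 - (s - t) = ℓ := ⟨_, rfl⟩
  have hn' : n = ℓ + 1 + (s - t) := by omega
  subst hn'
  rw [hℓ]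
  exact band_iff_all ℓ s t j (by omega) ht hs

end C047

end TriangleCap

end PercRepro
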